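import Summits.ResolutionOfSingularities.ResolutionOfSingularities.Theorems.PAlterationPialtSqueeze
import Summits.ResolutionOfSingularities.ResolutionOfSingularities.Theorems.PAlterationPialtFrobeniusFFinite
import Summits.ResolutionOfSingularities.ResolutionOfSingularities.Theorems.PAlterationPialtTameExactness
import HarnessLib

/-!
# `Pialt` (crux stmt-ResolutionOfSingularities-0555), line `SketchIdeator2` / Card A: the squeeze over
# F-FINITE fields, and the tame kernel from the atoms

Helper file of the line lead (c1), companion of `Theorems/PAlterationPialtSqueeze.lean`
(`--supports stmt-ResolutionOfSingularities-0555`; it does not close the item).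

* `isLocallyUniformizable_of_temkin2013_of_picover_of_frobenius_finiteType` — the squeeze
  `Temkin2013 ∧ Picover ⇒ classical local uniformization on K itself` holds over every
  **F-finite** field `k` of characteristic `p` (`[k : k^p] < ∞`, hypothesis
  `(frobenius k p).FiniteType`), not only over perfect ones: the only use of perfectness in the
  perfect-field proof is Frobenius domination, which the tree has over F-finite fields
  (`exists_frobeniusCover_of_frobenius_finiteType`, Temkin 2013 Rem. 1.3.5 (i): "if
  `[k : k^p] < ∞` then `h` is finite").
* `hasResolution_of_frobenius_finiteType_of_temkin2013_picover_twoModelPatching` — hence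
  `Temkin2013 ∧ Picover ∧ ProperModel.TwoModelPatching p` resolve every reduced separated scheme
  of finite type over every F-finite field of characteristic `p` (Zariski–Piltant engine
  `resolutionOverUpToDim_of_properPatching_of_lu`). Over fields with `[k : k^p] = ∞` the
  Frobenius-dominating scheme is not of finite type and the argument stops (barrier
  `Literature.Barriers.ResolutionOfSingularities.InseparableBaseChange` / crux
  `DescentPerfectToAll`, stmt-0549, for the passage to all fields).
* `tameResolutionInChar_of_temkin2013_picover_twoModelPatching`,
  `twoModelTamePatching_of_temkin2013_picover_twoModelPatching` — the residual of the tame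
  half of the line (`TameResolutionInChar p`, and its EXACT kernel `TwoModelTamePatching p` of
  `PAlterationPialtTameDefs.lean` / `…TameExactness.lean`) is DOMINATED by the lead's atoms:
  `Temkin2013 ∧ Picover ∧ TwoModelPatching p ⇒ TwoModelTamePatching p`. So of the two
  kernel-checked residual sets of the line, {Temkin2013, TwoModelTamePatching, Picover,
  TwoModelPatching, Nagata} (stub seats) and {Temkin2013, Picover, TwoModelPatching} (lead c1),
  the second is a subset of the first.

Sources: M. Temkin, J. Algebra 373 (2013), Thm. 1.3.2, Rem. 1.3.5 (i); O. Piltant, RACSAM 107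
(2013), Prop. 5.1; O. Zariski, Ann. of Math. 41 (1940).
-/

set_option linter.dupNamespace false -- mandated namespace of this single-conjunct summit

noncomputable section

open CategoryTheory CategoryTheory.Limits AlgebraicGeometry TopologicalSpace IsLocalRing
open Literature.AlgebraicGeometry.Resolution

namespace Summit.ResolutionOfSingularities.ResolutionOfSingularities.Theorems.Pialt.RadiciallyRegular

open Summit.ResolutionOfSingularities.ResolutionOfSingularities.Theses.PAlteration (Pialt Picover)

/-! ## Local uniformization over F-finite fields from `Temkin2013 ∧ Picover` -/

/-- **Over an F-finite field, `Temkin2013 ∧ Picover` give classical local uniformization on `K`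
itself.** Let `k` be a field of characteristic `p` with `(frobenius k p).FiniteType`
(`[k : k^p] < ∞`), `K/k` finitely generated and `O ∋ k` a valuation ring of `K`. By
`exists_normal_rrModel_le_of_temkin2013` some finitely generated, normal affine model `T ⊆ O` of
`K` is dominated finitely, radicially and surjectively by an integral regular `W`; as `Spec T`
is normal and `k` is F-finite, Frobenius domination
(`exists_frobeniusCover_of_frobenius_finiteType`) exhibits a scheme `N ≅ Spec T` as a finite,
universally injective, surjective cover of the REGULAR `W`, which `Picover` resolves; a
resolution of the affine model `Spec T` uniformizes `O`
(`exists_affineModel_regular_of_hasResolution`). [cite: Temkin2013, Thm. 1.3.2 and Rem. 1.3.5 (i)] -/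
theorem isLocallyUniformizable_of_temkin2013_of_picover_of_frobenius_finiteType
    (hT : Temkin2013.{0}) (hPc : Picover) (p : ℕ) [Fact p.Prime] (k K : Type) [Field k]
    [CharP k p] (hk : (frobenius k p).FiniteType) [Field K] [Algebra k K]
    (hfg : (⊤ : IntermediateField k K).FG) (O : ValuationSubring K)
    (hO : ∀ c : k, algebraMap k K c ∈ O) : IsLocallyUniformizable k K O := by
  have hp : p.Prime := Fact.out
  obtain ⟨T, hTO, hTfg, hTfr, hTn, W, h, hW, hreg, hfin, hui, hsurj⟩ :=
    exists_normal_rrModel_le_of_temkin2013 hT p k K hfg O hO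
  haveI := hTfr
  haveI := hW
  haveI := hfin
  haveI := hui
  haveI := hTn
  haveI : Algebra.FiniteType k T := T.fg_iff_finiteType.mp hTfg
  -- `Spec T` as an integral, normal `k`-scheme of finite type
  haveI : IsDomain (CommRingCat.of T) := inferInstanceAs (IsDomain T)
  haveI : IsIntegrallyClosed (CommRingCat.of T) := hTn
  let fT : Spec (.of T) ⟶ Spec (.of k) := Spec.map (CommRingCat.ofHom (algebraMap k T))
  haveI : LocallyOfFiniteType fT :=
    (HasRingHomProperty.Spec_iff (P := @LocallyOfFiniteType)).mpr
      (RingHom.finiteType_algebraMap.mpr ‹_›)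
  have hTn' : ∀ y : Spec (.of T), IsIntegrallyClosed ((Spec (.of T)).presheaf.stalk y) :=
    Literature.AlgebraicGeometry.Motives.isIntegrallyClosed_stalk_Spec (.of T)
  haveI : IsDominant h := ⟨hsurj.denseRange⟩
  -- Frobenius domination over the F-finite field `k`
  obtain ⟨N, ψ, φ, hNint, hφ, hψfin, hψui, hψsurj⟩ :=
    exists_frobeniusCover_of_frobenius_finiteType p k hk W (Spec (.of T)) fT h hTn'
  haveI := hNint
  haveI := hφ
  haveI := hψfin
  haveI := hψui
  -- `Picover` resolves `N`, hence `Spec T`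
  haveI : IsSeparated (h ≫ fT) := inferInstance
  haveI : LocallyOfFiniteType (h ≫ fT) := inferInstance
  haveI : QuasiCompact (h ≫ fT) := inferInstance
  have hres : Scheme.HasResolution N :=
    hPc p hp k W N (h ≫ fT) ψ inferInstance inferInstance inferInstance hW hreg hNint
      hψfin hψui hψsurj
  have hresT : Scheme.HasResolution (Spec (.of T)) := Scheme.HasResolution.of_iso φ hres
  -- a resolution of the affine model `T ⊆ O` uniformizes `O`
  obtain ⟨A', h', hle, hA'fg, hreg'⟩ :=
    exists_affineModel_regular_of_hasResolution O T hTO hTfg hTfr hresT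
  exact ⟨A', h', hA'fg, isFractionRing_of_le hle hTfr, hreg'⟩

/-- **`Temkin2013 ∧ Picover ∧ TwoModelPatching p` resolve every reduced separated scheme of
finite type over an F-finite field of characteristic `p`** (Zariski's programme with proper
models and absolute local uniformization, `resolutionOverUpToDim_of_properPatching_of_lu`, fed
with `isLocallyUniformizable_of_temkin2013_of_picover_of_frobenius_finiteType`).
[cite: Piltant2013, Prop. 5.1 and Cor. 5.7] -/
theorem hasResolution_of_frobenius_finiteType_of_temkin2013_picover_twoModelPatching
    (hT : Temkin2013.{0}) (hPc : Picover) (p : ℕ) [Fact p.Prime]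
    (hZ : ProperModel.TwoModelPatching.{0} p) (k : Type) [Field k] [CharP k p]
    (hk : (frobenius k p).FiniteType) (X : Scheme.{0}) (f : X ⟶ Spec (.of k))
    [IsSeparated f] [LocallyOfFiniteType f] [QuasiCompact f] [IsReduced X] :
    Scheme.HasResolution X := by
  haveI : CompactSpace X := QuasiCompact.compactSpace_of_compactSpace f
  obtain ⟨d, hd⟩ := exists_topologicalKrullDim_le_of_locallyOfFiniteType f
  exact resolutionOverUpToDim_of_properPatching_of_lu (fun K _ _ _ M₁ M₂ => hZ k K M₁ M₂)
    (fun K _ _ hKfg O hO =>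
      isLocallyUniformizable_of_temkin2013_of_picover_of_frobenius_finiteType hT hPc p k K hk
        hKfg O hO)
    d X f ‹_› ‹_› ‹_› ‹_› hd

/-! ## The tame half's residual is dominated by the atoms -/

/-- **`TameResolutionInChar p` from the atoms**: `Temkin2013 ∧ Picover ∧ (∀ p, TwoModelPatching p)`
imply tame resolution in characteristic `p` (the statement of `stub_tameResolution` at `p`,
`PAlterationPialtTameDefs.lean`), through resolution over perfect fields
(`stub_tameResolution_of_temkin2013_picover_twoModelPatching`). [folklore] -/
theorem tameResolutionInChar_of_temkin2013_picover_twoModelPatching (hT : Temkin2013.{0})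
    (hPc : Picover) (hZ : ∀ p : ℕ, p.Prime → ProperModel.TwoModelPatching.{0} p)
    (p : ℕ) (hp : p.Prime) : TameResolutionInChar p := by
  intro k _ _ _ X f hs hl hq hi
  haveI := hs
  haveI := hl
  haveI := hq
  haveI := hi
  exact stub_tameResolution_of_temkin2013_picover_twoModelPatching hT hPc hZ p hp k X f

/-- **The tame kernel from the atoms**: `Temkin2013 ∧ Picover ∧ (∀ p, TwoModelPatching p)` imply
Piltant's two-model patching of proper models for `P = P_LRR` over perfect fields of
characteristic `p` (`TwoModelTamePatching p`, the exact residual of `stub_tameResolution` modulo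
`Temkin2013`, `tame_iff_twoModelTamePatching_of_temkin2013`) — via tame resolution and
`twoModelTamePatching_of_tame` (resolve the join of the two models tamely). Hence the residual
set {`Temkin2013`, `Picover`, `TwoModelPatching`} of the lead dominates the stub seats'
{`Temkin2013`, `TwoModelTamePatching`, `Picover`, `TwoModelPatching`, `Nagata`}.
[cite: Piltant2013, Prop. 5.1] -/
theorem twoModelTamePatching_of_temkin2013_picover_twoModelPatching (hT : Temkin2013.{0})
    (hPc : Picover) (hZ : ∀ p : ℕ, p.Prime → ProperModel.TwoModelPatching.{0} p)
    (p : ℕ) (hp : p.Prime) : TwoModelTamePatching p :=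
  twoModelTamePatching_of_tame p
    (tameResolutionInChar_of_temkin2013_picover_twoModelPatching hT hPc hZ p hp)

end Summit.ResolutionOfSingularities.ResolutionOfSingularities.Theorems.Pialt.RadiciallyRegular

end
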